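import Summits.QuantumFields.BalabanUV.T4Continuum.Support.DirichletCornerCutoutCover
import Summits.QuantumFields.BalabanUV.T4Continuum.Support.DirichletVertexCubes

/-!
# `BalabanUV.T4Continuum.Support.DirichletCutoutVertices` — NE2 (node U1a) formalisation swarm, sub-row `T4-U1a.S-NE2-D1-DIRICHLET°`, supplier item
# «Δ1-SKELETON» (file 17): THE VERTEX OF A CORNER BUNDLE — a site that is near the bottom plane of a `−μ`-exposed block `β` and near a face
# plane of `β` along EVERY transversal axis (in `d = 3`: every site of a corner bundle `NC`) lies within `ρ + 1` of an explicit block-lattice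
# vertex `vtxOf` whose explicit octant `sigOf` is the exterior block `β − e_μ`; hence it belongs to the ACTIVE VERTEX FAMILY `ActV S` on which
# files 14–16 make the local energy and mass decay (unit b2b-balaban-t4-ne2-formalise-leaf-08, gen 7, file 17)

HONEST FRAMING.  Lattice geometry at MODEL level (finite torus); [folklore]; NE2 (U1a) is NOT proved by this file; spine PROVED 0/9 unchanged;
NOT infinite volume, NOT the mass gap, NOT Clay.  HONEST DEPENDENCY (verbatim): «continuum YM on T⁴ ⇐ BetaPertH ∧ nine spine estimates (0/9
proved); BetaPertH ⇐ (D1) ∧ (D4) ∧ CAP+tail; G-an2-4 gates asym, D1 and NE2/3/4.»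

WHAT THIS FILE PROVES (0 sorry).  Data `tauOf`, `vtxOf`, `sigOf`, `ActV`, `sigAct`; `sum_unitVec_apply`, `vtxOf_apply`, `cornerBlock_apply`,
**`nearVtx_vtxOf`**, **`cornerBlock_vtxOf`**, `vtxOf_mem_ActV`, `sigAct_spec`, the `d = 3` pigeonhole `trans_axes_of_three`, and the END
**`exists_nearVtx_of_NC`** (`d = 3`: `CornerIdx β κ₁ κ₂ ∧ NC ρ β κ₁ κ₂ y ⇒ ∃ β′ ∈ ActV S, NearVtx (ρ+1) β′ y`).

ABSOLUTE RULE (cell, verbatim): «No internally-minted statement may enter as a cited fact. Every hypothesis is either kernel-proved in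
this package or a verbatim quotation of a PUBLISHED theorem with page reference. The manuscript(s) under audit are NOT citable for
their own disputed steps — they are the thing under adjudication; programme-internal (2001/route/tribunal) claims are never citable.»
[folklore]; data definitions only; no `def … : Prop` fact.  NOT CLAIMED: any estimate, NE2, NE3.
-/

noncomputable section

open scoped BigOperators ComplexConjugate Matrix
open Finset

namespace Summit.QuantumFields.BalabanUV.T4Continuum.DirichletCutoutVertices

open Literature.MathematicalPhysics.QuantumFieldTheory.Balaban1983to89.B5Prop11Plancherel (Tor fine unitVec)
open Literature.MathematicalPhysics.QuantumFieldTheory.Balaban1983to89.B5Blocks16 (blockOf)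
open Summit.QuantumFields.BalabanUV.T4Continuum.DirichletMonotoneCutoff (offsF)
open Summit.QuantumFields.BalabanUV.T4Continuum.DirichletMorreyDecayBlock (cornerBlock)
open Summit.QuantumFields.BalabanUV.T4Continuum.DirichletDipCutoff (BotExp)
open Summit.QuantumFields.BalabanUV.T4Continuum.DirichletCornerCutoutEta (CornerIdx)
open Summit.QuantumFields.BalabanUV.T4Continuum.DirichletCornerCutoutCover (NearPlaneR NearFaceR NC)
open Summit.QuantumFields.BalabanUV.T4Continuum.DirichletVertexCubes (NearVtx)

variable {d : ℕ} (n : ℕ) [NeZero n] (M : Fin d → ℕ) [hM : ∀ μ, NeZero (M μ)] (μ : Fin d)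

/-- which transversal coordinates of the vertex are the UPPER face of `β` (read off the site). [folklore] -/
def tauOf (ρ : ℕ) (β : Tor M) (y : Tor (fine n M)) (lam : Fin d) : Bool :=
  decide (lam ≠ μ ∧ ((blockOf n M y lam = β lam ∧ ¬ (offsF n M y lam : ℕ) ≤ ρ) ∨ (blockOf n M y lam = β lam + 1 ∧ (offsF n M y lam : ℕ) ≤ ρ)))

/-- the vertex of the corner bundle nearest to the site. [folklore] -/
def vtxOf (ρ : ℕ) (β : Tor M) (y : Tor (fine n M)) : Tor M :=
  β + ∑ lam ∈ univ.filter (fun lam => tauOf n M μ ρ β y lam = true), unitVec M lam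

/-- the octant at that vertex pointing into the exterior block `β − e_μ`. [folklore] -/
def sigOf (ρ : ℕ) (β : Tor M) (y : Tor (fine n M)) (lam : Fin d) : Bool := !(decide (lam = μ) || tauOf n M μ ρ β y lam)

/-- the ACTIVE VERTEX FAMILY of a block set: the blocks whose lower corner touches an exterior block. [folklore] -/
def ActV (S : Tor M → Prop) [DecidablePred S] : Finset (Tor M) := univ.filter fun β' => ∃ σ : Fin d → Bool, ¬ S (cornerBlock M β' σ)

/-- a chosen exterior octant at every active vertex. [folklore] -/
def sigAct (S : Tor M → Prop) [DecidablePred S] (β' : Tor M) : Fin d → Bool :=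
  if h : ∃ σ : Fin d → Bool, ¬ S (cornerBlock M β' σ) then Classical.choose h else fun _ => true

section Apply

variable {M μ}

omit hM in
/-- a sum of unit vectors, componentwise. [folklore] -/
theorem sum_unitVec_apply (s : Finset (Fin d)) (lam : Fin d) :
    (∑ l ∈ s, unitVec M l) lam = if lam ∈ s then (1 : ZMod (M lam)) else 0 := by
  rw [Finset.sum_apply]
  by_cases h : lam ∈ s
  · rw [if_pos h, Finset.sum_eq_single_of_mem lam h (fun l _ hl => by rw [unitVec, Pi.single_eq_of_ne (Ne.symm hl)])]
    rw [unitVec, Pi.single_eq_same]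
  · rw [if_neg h]
    exact Finset.sum_eq_zero fun l hl => by
      rw [unitVec, Pi.single_eq_of_ne]
      rintro rfl
      exact h hl

omit hM in
/-- the exterior block of an octant, componentwise. [folklore] -/
theorem cornerBlock_apply (β' : Tor M) (σ : Fin d → Bool) (lam : Fin d) :
    cornerBlock M β' σ lam = β' lam - (if σ lam = false then (1 : ZMod (M lam)) else 0) := by
  rw [cornerBlock, Pi.sub_apply, sum_unitVec_apply]
  simp only [mem_filter, mem_univ, true_and]

variable {n}

/-- the vertex, componentwise. [folklore] -/
theorem vtxOf_apply (ρ : ℕ) (β : Tor M) (y : Tor (fine n M)) (lam : Fin d) :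
    vtxOf n M μ ρ β y lam = β lam + (if tauOf n M μ ρ β y lam = true then (1 : ZMod (M lam)) else 0) := by
  rw [vtxOf, Pi.add_apply, sum_unitVec_apply]
  simp only [mem_filter, mem_univ, true_and]

/-- **the octant of the vertex is the exterior block `β − e_μ`.** [folklore] -/
theorem cornerBlock_vtxOf (ρ : ℕ) (β : Tor M) (y : Tor (fine n M)) :
    cornerBlock M (vtxOf n M μ ρ β y) (sigOf n M μ ρ β y) = β - unitVec M μ := by
  funext lam
  rw [cornerBlock_apply, vtxOf_apply, Pi.sub_apply]
  by_cases hl : lam = μ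
  · subst hl
    have ht : tauOf n M lam ρ β y lam = false := by simp [tauOf]
    simp [sigOf, ht, unitVec]
  · have hu : unitVec M μ lam = 0 := by simp [unitVec, hl]
    rw [hu, sub_zero]
    cases ht : tauOf n M μ ρ β y lam <;> simp [sigOf, ht, hl]

/-- **the vertex is within `ρ + 1` of every site of the bundle** (near the bottom plane along `μ`, near a face plane along every other axis).
[folklore] -/
theorem nearVtx_vtxOf {ρ : ℕ} {β : Tor M} {y : Tor (fine n M)} (hP : NearPlaneR n M μ ρ β y)
    (hall : ∀ lam, lam ≠ μ → NearFaceR n M ρ β lam y) : NearVtx n M (ρ + 1) (vtxOf n M μ ρ β y) y := by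
  intro lam
  rw [vtxOf_apply]
  by_cases hl : lam = μ
  · subst hl
    have ht : tauOf n M lam ρ β y lam = false := by simp [tauOf]
    rw [ht]
    simp only [Bool.false_eq_true, if_false, add_zero]
    rcases hP with ⟨hb, ho⟩ | ⟨hb, ho⟩
    · exact Or.inl ⟨hb, by omega⟩
    · exact Or.inr ⟨hb, by omega⟩
  · have hF := hall lam hl
    cases ht : tauOf n M μ ρ β y lam
    · -- lower face coordinate `β lam`
      simp only [Bool.false_eq_true, if_false, add_zero]
      have hnot' : ¬ (lam ≠ μ ∧ ((blockOf n M y lam = β lam ∧ ¬ (offsF n M y lam : ℕ) ≤ ρ)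
          ∨ (blockOf n M y lam = β lam + 1 ∧ (offsF n M y lam : ℕ) ≤ ρ))) := by
        simpa only [tauOf, decide_eq_false_iff_not] using ht
      have hnot : ¬ ((blockOf n M y lam = β lam ∧ ¬ (offsF n M y lam : ℕ) ≤ ρ)
          ∨ (blockOf n M y lam = β lam + 1 ∧ (offsF n M y lam : ℕ) ≤ ρ)) := fun h => hnot' ⟨hl, h⟩
      rcases hF with ⟨hb, ho⟩ | ⟨hb, ho⟩ | ⟨hb, ho⟩
      · have : (offsF n M y lam : ℕ) ≤ ρ := by
          by_contra h'; exact hnot (Or.inl ⟨hb, h'⟩)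
        exact Or.inl ⟨hb, by omega⟩
      · exact absurd (Or.inr ⟨hb, ho⟩) hnot
      · exact Or.inr ⟨hb, by omega⟩
    · -- upper face coordinate `β lam + 1`
      simp only [if_true]
      have hyes' : lam ≠ μ ∧ ((blockOf n M y lam = β lam ∧ ¬ (offsF n M y lam : ℕ) ≤ ρ)
          ∨ (blockOf n M y lam = β lam + 1 ∧ (offsF n M y lam : ℕ) ≤ ρ)) := by
        simpa only [tauOf, decide_eq_true_eq] using ht
      rcases hyes'.2 with ⟨hb, ho⟩ | ⟨hb, ho⟩
      · refine Or.inr ⟨by rw [hb, add_sub_cancel_right], ?_⟩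
        rcases hF with ⟨_, ho'⟩ | ⟨_, ho'⟩ | ⟨_, ho'⟩
        · rcases ho' with ho' | ho'
          · exact absurd ho' ho
          · omega
        · exact absurd ho' ho
        · omega
      · exact Or.inl ⟨hb, by omega⟩

end Apply

section Active

variable {n M μ}

/-- the vertex of a bundle at a `−μ`-exposed block is active. [folklore] -/
theorem vtxOf_mem_ActV (S : Tor M → Prop) [DecidablePred S] {β : Tor M} (hBE : BotExp M S μ β) (ρ : ℕ) (y : Tor (fine n M)) :
    vtxOf n M μ ρ β y ∈ ActV M S := by
  rw [ActV, mem_filter]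
  exact ⟨mem_univ _, sigOf n M μ ρ β y, by rw [cornerBlock_vtxOf]; exact hBE.2⟩

/-- the chosen octant at an active vertex is exterior. [folklore] -/
theorem sigAct_spec (S : Tor M → Prop) [DecidablePred S] {β' : Tor M} (h : β' ∈ ActV M S) : ¬ S (cornerBlock M β' (sigAct M S β')) := by
  rw [ActV, mem_filter] at h
  rw [sigAct, dif_pos h.2]
  exact Classical.choose_spec h.2

end Active

/-! ## `d = 3`: every transversal axis is one of the two corner axes -/

/-- pigeonhole on three axes. [folklore] -/
theorem trans_axes_of_three (hd : d = 3) {μ κ₁ κ₂ : Fin d} (h₁ : κ₁ ≠ μ) (h₂ : κ₂ ≠ μ) (h₁₂ : κ₁ ≠ κ₂) (lam : Fin d) (hl : lam ≠ μ) :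
    lam = κ₁ ∨ lam = κ₂ := by
  subst hd
  revert μ κ₁ κ₂ lam
  decide

section End

variable {n M μ}

/-- **THE END (`d = 3`)**: every site of the radius-`ρ` bundle of a valid corner index lies within `ρ + 1` of an ACTIVE vertex. [folklore] -/
theorem exists_nearVtx_of_NC (hd : d = 3) (S : Tor M → Prop) [DecidablePred S] {ρ : ℕ} {β : Tor M} {κ₁ κ₂ : Fin d} {y : Tor (fine n M)}
    (hidx : CornerIdx M S μ β κ₁ κ₂) (hNC : NC n M μ ρ β κ₁ κ₂ y) : ∃ β' ∈ ActV M S, NearVtx n M (ρ + 1) β' y := by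
  refine ⟨vtxOf n M μ ρ β y, vtxOf_mem_ActV S hidx.1 ρ y, nearVtx_vtxOf hNC.1 fun lam hl => ?_⟩
  rcases trans_axes_of_three hd hidx.2.1 hidx.2.2.1 hidx.2.2.2 lam hl with h | h
  · rw [h]; exact hNC.2.1
  · rw [h]; exact hNC.2.2.1

end End

end Summit.QuantumFields.BalabanUV.T4Continuum.DirichletCutoutVertices

end
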